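import Mathlib.Topology.Order.MonotoneConvergence
import Literature.Probability.LatticeModels.IsingAutomorphismCovariance
import Literature.Probability.LatticeModels.PlusDomainCorrComparison
import Literature.Probability.LatticeModels.ThermodynamicLimit
import Literature.Probability.LatticeModels.Correlations
import Literature.Probability.LatticeModels.GKSInequalities
import HarnessLib

/-!
# Route GaussianScaleMixture — crux `RotationUpgradeFromTwoPoint` (stmt-CriticalPhenomena-8367),
# line `two-crystals-generate-so3`, stub `stub_hexPlusStateSixfold`

THEOREM-ONLY file (no definitions, no named facts). The finite-lattice input of the line: the
box-limit `+` state of ANY locally finite graph `G` on the vertex set `ℤ³ = Site 3` whose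
adjacency is "`y − x` is one of the eight bond vectors `±e₀, ±e₁, ±e₂, ±(e₀ − e₁)`" (the
stacked-triangular ferromagnet `T`) is EXACTLY invariant, on spin monomials and for every `β ≥ 0`,
under the sixfold lattice map `M̃ = !![0,-1,0; 1,1,0; 0,0,1]`:

  `lim_L ⟨∏ᵢ σ_{M̃ kᵢ}⟩⁺_{B(L);β,0} = lim_L ⟨∏ᵢ σ_{kᵢ}⟩⁺_{B(L);β,0}`.

Proof (Friedli–Velenik 2017, §3.1 with Exercise 6.21, and Exercise 3.12 / Lemma 3.22):

* `M̃` has the integer inverse `!![1,1,0; -1,0,0; 0,0,1]` and permutes the bond set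
  (`M̃e₀ = e₁`, `M̃e₁ = -(e₀ - e₁)`, `M̃e₂ = e₂`, `M̃(e₀ - e₁) = e₀`; all checked by `decide`), so
  `k ↦ M̃k` is a graph automorphism `φ` of `G`;
* finite-volume covariance (tree `isingExpect_fixed_relabel`; the constant configuration `+1` is
  relabel-invariant): `⟨∏ σ_{φ kᵢ}⟩⁺_{φ(Λ)} = ⟨∏ σ_{kᵢ}⟩⁺_Λ`
  (`hexPlus_isingExpect_plus_map_equiv`);
* `Λ ↦ ⟨∏ σ_{kᵢ}⟩⁺_{Λ;β,0}` is antitone for `β ≥ 0` (tree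
  `isingExpect_plus_spinMonomial_anti_volume`) and `≥ -1`, so along the increasing boxes it tends to
  its infimum (`tendsto_atTop_ciInf`), and both `limUnder`s are these infima;
* every finite volume — in particular every image box `φ(B(L))` — lies in some box
  (`exists_forall_subset_box`), whence `inf_L ⟨∏ σ_{φ k}⟩⁺_{B(L)} ≤ inf_L ⟨∏ σ_k⟩⁺_{B(L)}`
  (`hexPlus_iInf_box_equiv_le`); the same with `φ⁻¹` and `φ ∘ k` gives the reverse inequality.

The analytic part is stated for a general dimension `d`, a general bond predicate `P` and a general
pair of mutually inverse integer matrices preserving `P` (`hexPlus_limUnder_box_mulVec_eq`); the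
registered stub is its specialisation.

## References

* S. Friedli, Y. Velenik, *Statistical Mechanics of Lattice Systems* (CUP 2017), §3.1,
  Exercise 3.12 (p. 112), Lemma 3.22 (p. 111), Exercise 6.21.
-/

noncomputable section

open Literature.Probability.LatticeModels Finset Filter
open scoped Topology

namespace Summit.CriticalPhenomena.Ising3DConformalLimit.Cruxes.RotationUpgradeFromTwoPoint.TwoCrystalsGenerateSo3

/-- `-1 ≤ ⟨∏ᵢ σ_{kᵢ}⟩^{bc}_{Λ;β,h}`: a spin monomial is a spin product `σ_A`, and `|⟨σ_A⟩| ≤ 1`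
(Friedli–Velenik 2017, §3.6.1). [folklore] -/
theorem hexPlus_neg_one_le_isingExpect {V : Type*} [DecidableEq V] (G : SimpleGraph V)
    [G.LocallyFinite] (Λ : Finset V) (β h : ℝ) (bc : BoundaryCondition V) {n : ℕ}
    (k : Fin n → V) : -1 ≤ isingExpect G Λ β h bc (spinMonomial k) := by
  obtain ⟨A, -, hA⟩ := exists_subset_image_spinMonomial_eq_spinProduct k
  rw [hA]
  exact (abs_le.1 (abs_isingCorr_le_one G Λ β h bc A)).1

/-- **Finite-volume covariance of the `+` state on spin monomials under a graph automorphism**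
(Friedli–Velenik 2017, §3.1 and Exercise 6.21): for a bijection `e` of the sites preserving
adjacency, `⟨∏ᵢ σ_{e kᵢ}⟩⁺_{e(Λ);β,h} = ⟨∏ᵢ σ_{kᵢ}⟩⁺_{Λ;β,h}` — the tree's
`isingExpect_fixed_relabel` at the relabel-invariant boundary configuration `+1`.
[cite: FriedliVelenik2017, §3.1] -/
theorem hexPlus_isingExpect_plus_map_equiv {V : Type*} [DecidableEq V] (G : SimpleGraph V)
    [G.LocallyFinite] (e : V ≃ V) (he : ∀ a b, G.Adj (e a) (e b) ↔ G.Adj a b) (Λ : Finset V)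
    (β h : ℝ) {n : ℕ} (k : Fin n → V) :
    isingExpect G (Λ.map e.toEmbedding) β h .plus (spinMonomial fun i => e (k i)) =
      isingExpect G Λ β h .plus (spinMonomial k) := by
  have hF : Measurable (spinMonomial fun i => e (k i)) := measurable_spinMonomial _
  have h1 : isingExpect G (Λ.map e.toEmbedding) β h (.fixed (configRelabel e 1))
      (spinMonomial fun i => e (k i)) =
      isingExpect G Λ β h (.fixed 1) ((spinMonomial fun i => e (k i)) ∘ configRelabel e) :=
    isingExpect_fixed_relabel G ⟨e, he _ _⟩ Λ β h 1 hF
  have h2 : (spinMonomial fun i => e (k i)) ∘ configRelabel e = spinMonomial k := by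
    funext σ
    simp only [Function.comp_apply, spinMonomial, spinAt_apply_configRelabel]
  have h3 : configRelabel e (1 : SpinConfig V) = 1 := rfl
  rw [h2, h3] at h1
  exact h1

/-- **Convergence of the box `+` state on spin monomials to its infimum** (Friedli–Velenik 2017,
Exercise 3.12 / Lemma 3.22: for `β ≥ 0` the finite-volume `+` expectations of `∏ᵢ σ_{kᵢ}` are
nonincreasing in the volume; they are `≥ -1`), on any locally finite graph on `ℤ^d`:
`⟨∏ᵢ σ_{kᵢ}⟩⁺_{B(L);β,0} → inf_L ⟨∏ᵢ σ_{kᵢ}⟩⁺_{B(L);β,0}`. [cite: FriedliVelenik2017, Exercise 3.12, p. 112] -/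
theorem hexPlus_tendsto_isingExpect_box {d : ℕ} (G : SimpleGraph (Site d)) [G.LocallyFinite]
    {β : ℝ} (hβ : 0 ≤ β) {n : ℕ} (k : Fin n → Site d) :
    Tendsto (fun L : ℕ => isingExpect G (box d L) β 0 .plus (spinMonomial k)) atTop
      (𝓝 (⨅ L : ℕ, isingExpect G (box d L) β 0 .plus (spinMonomial k))) :=
  tendsto_atTop_ciInf
    (fun _ _ hLL' => isingExpect_plus_spinMonomial_anti_volume G hβ le_rfl (box_mono d hLL') k)
    ⟨-1, Set.forall_mem_range.2 fun L => hexPlus_neg_one_le_isingExpect G (box d L) β 0 .plus k⟩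

/-- **Relabelled monomials have the smaller infimum**: for an adjacency-preserving bijection `e` of
`ℤ^d` and `β ≥ 0`, `inf_L ⟨∏ᵢ σ_{e kᵢ}⟩⁺_{B(L);β,0} ≤ inf_L ⟨∏ᵢ σ_{kᵢ}⟩⁺_{B(L);β,0}`: the image
box `e(B(L))` lies in some box `B(L')`, and by volume antitonicity and covariance
`⟨∏ σ_{e k}⟩⁺_{B(L')} ≤ ⟨∏ σ_{e k}⟩⁺_{e(B(L))} = ⟨∏ σ_k⟩⁺_{B(L)}` (Friedli–Velenik 2017,
Exercise 3.12 and §3.1). [folklore] -/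
theorem hexPlus_iInf_box_equiv_le {d : ℕ} (G : SimpleGraph (Site d)) [G.LocallyFinite]
    (e : Site d ≃ Site d) (he : ∀ a b, G.Adj (e a) (e b) ↔ G.Adj a b) {β : ℝ} (hβ : 0 ≤ β)
    {n : ℕ} (k : Fin n → Site d) :
    ⨅ L : ℕ, isingExpect G (box d L) β 0 .plus (spinMonomial fun i => e (k i)) ≤
      ⨅ L : ℕ, isingExpect G (box d L) β 0 .plus (spinMonomial k) := by
  refine le_ciInf fun L => ?_
  obtain ⟨L₀, hL₀⟩ := exists_forall_subset_box d ((box d L).map e.toEmbedding)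
  calc ⨅ L' : ℕ, isingExpect G (box d L') β 0 .plus (spinMonomial fun i => e (k i))
      ≤ isingExpect G (box d L₀) β 0 .plus (spinMonomial fun i => e (k i)) :=
        ciInf_le ⟨-1, Set.forall_mem_range.2 fun L' =>
          hexPlus_neg_one_le_isingExpect G (box d L') β 0 .plus _⟩ L₀
    _ ≤ isingExpect G ((box d L).map e.toEmbedding) β 0 .plus (spinMonomial fun i => e (k i)) :=
        isingExpect_plus_spinMonomial_anti_volume G hβ le_rfl (hL₀ L₀ le_rfl) _
    _ = isingExpect G (box d L) β 0 .plus (spinMonomial k) :=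
        hexPlus_isingExpect_plus_map_equiv G e he (box d L) β 0 k

/-- **Exact lattice symmetry of the box-limit `+` state** (general form). Let `G` be a locally
finite graph on `ℤ^d` whose adjacency is `x ∼ y ↔ P (y - x)` for a bond predicate `P`, and let
`M, N` be mutually inverse integer matrices both preserving `P`. Then for `β ≥ 0` and every spin
monomial, `lim_L ⟨∏ᵢ σ_{M kᵢ}⟩⁺_{B(L);β,0} = lim_L ⟨∏ᵢ σ_{kᵢ}⟩⁺_{B(L);β,0}`: `k ↦ Mk` is a graph
automorphism, both sides are infima over the (cofinal) boxes by antitonicity in the volume, and the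
two one-sided comparisons are `hexPlus_iInf_box_equiv_le` for `M` and for `N = M⁻¹`
(Friedli–Velenik 2017, §3.1, Exercise 6.21, Exercise 3.12). [folklore] -/
theorem hexPlus_limUnder_box_mulVec_eq {d : ℕ} (G : SimpleGraph (Site d)) [G.LocallyFinite]
    (P : Site d → Prop) (hG : ∀ x y : Site d, G.Adj x y ↔ P (y - x))
    (M N : Matrix (Fin d) (Fin d) ℤ) (hMN : M * N = 1) (hNM : N * M = 1)
    (hPM : ∀ v, P v → P (M.mulVec v)) (hPN : ∀ v, P v → P (N.mulVec v))
    {β : ℝ} (hβ : 0 ≤ β) {n : ℕ} (k : Fin n → Site d) :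
    limUnder atTop (fun L : ℕ => isingExpect G (box d L) β 0 .plus
        (spinMonomial fun i => M.mulVec (k i))) =
      limUnder atTop (fun L : ℕ => isingExpect G (box d L) β 0 .plus (spinMonomial k)) := by
  have hNMv : ∀ v, N.mulVec (M.mulVec v) = v := fun v => by
    rw [Matrix.mulVec_mulVec, hNM, Matrix.one_mulVec]
  have hMNv : ∀ v, M.mulVec (N.mulVec v) = v := fun v => by
    rw [Matrix.mulVec_mulVec, hMN, Matrix.one_mulVec]
  obtain ⟨e, he1, he2⟩ : ∃ e : Site d ≃ Site d, (∀ v, e v = M.mulVec v) ∧ ∀ v, e.symm v = N.mulVec v :=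
    ⟨⟨_, _, hNMv, hMNv⟩, fun _ => rfl, fun _ => rfl⟩
  have hPiff : ∀ v, P (M.mulVec v) ↔ P v := fun v =>
    ⟨fun hv => by simpa only [hNMv] using hPN _ hv, hPM v⟩
  have he : ∀ a b, G.Adj (e a) (e b) ↔ G.Adj a b := fun a b => by
    rw [hG, hG, he1, he1, ← Matrix.mulVec_sub, hPiff]
  have he' : ∀ a b, G.Adj (e.symm a) (e.symm b) ↔ G.Adj a b := fun a b => by
    simpa using (he (e.symm a) (e.symm b)).symm
  rw [(hexPlus_tendsto_isingExpect_box G hβ fun i => M.mulVec (k i)).limUnder_eq,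
    (hexPlus_tendsto_isingExpect_box G hβ k).limUnder_eq]
  refine le_antisymm ?_ ?_
  · simpa only [he1] using hexPlus_iInf_box_equiv_le G e he hβ k
  · simpa only [he2, he1, hNMv] using hexPlus_iInf_box_equiv_le G e.symm he' hβ fun i => e (k i)

/-- **Registered stub `stub_hexPlusStateSixfold`: exact sixfold symmetry of the second crystal.**
For ANY locally finite graph `G` on `ℤ³` whose adjacency is "`y − x` is one of the eight bond
vectors `±e₀, ±e₁, ±e₂, ±(e₀−e₁)`" (the stacked-triangular ferromagnet `T`) and every `β ≥ 0`, the
box-limit `+` state is invariant under `M̃ = !![0,-1,0; 1,1,0; 0,0,1]` on spin monomials: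
`lim_L ⟨∏ σ_{M̃ kᵢ}⟩⁺_{B(L)} = lim_L ⟨∏ σ_{kᵢ}⟩⁺_{B(L)}`. `M̃` has the integer inverse
`!![1,1,0; -1,0,0; 0,0,1]` and both permute the bond set (`decide`); conclude by
`hexPlus_limUnder_box_mulVec_eq` (Friedli–Velenik 2017, §3.1, Exercise 6.21, Exercise 3.12).
[folklore] -/
theorem stub_hexPlusStateSixfold :
  ∀ (G : SimpleGraph (Site 3)) [DecidableRel G.Adj] [G.LocallyFinite],
    (∀ x y : Site 3, G.Adj x y ↔
      ((∃ i : Fin 3, y - x = Pi.single i 1 ∨ y - x = -Pi.single i 1) ∨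
        y - x = ![1, -1, 0] ∨ y - x = ![-1, 1, 0])) →
    ∀ β : ℝ, 0 ≤ β → ∀ (n : ℕ) (k : Fin n → Site 3),
      limUnder atTop (fun L : ℕ => isingExpect G (box 3 L) β 0 .plus
        (spinMonomial (fun i => (!![0, -1, 0; 1, 1, 0; 0, 0, 1] : Matrix (Fin 3) (Fin 3) ℤ).mulVec (k i)))) =
      limUnder atTop (fun L : ℕ => isingExpect G (box 3 L) β 0 .plus (spinMonomial k)) := by
  intro G _ _ hG β hβ n k
  refine hexPlus_limUnder_box_mulVec_eq G
    (fun v => (∃ i : Fin 3, v = Pi.single i 1 ∨ v = -Pi.single i 1) ∨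
      v = ![1, -1, 0] ∨ v = ![-1, 1, 0])
    hG _ !![1, 1, 0; -1, 0, 0; 0, 0, 1] (by decide) (by decide) ?_ ?_ hβ k
  · rintro v (⟨i, rfl | rfl⟩ | rfl | rfl) <;> (try revert i) <;> decide
  · rintro v (⟨i, rfl | rfl⟩ | rfl | rfl) <;> (try revert i) <;> decide

end Summit.CriticalPhenomena.Ising3DConformalLimit.Cruxes.RotationUpgradeFromTwoPoint.TwoCrystalsGenerateSo3
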